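import Summits.ResolutionOfSingularities.ResolutionOfSingularities.Theorems.SectionAscentFibrewiseClosedPointsCertificateRegularLocQuot
import Summits.ResolutionOfSingularities.ResolutionOfSingularities.Theorems.SectionAscentFibrewiseClosedPointsCertificateRegularBaseChange
import Summits.ResolutionOfSingularities.ResolutionOfSingularities.Theorems.SectionAscentFibrewiseClosedPointsCertificateRegularStrictTransform
import Summits.ResolutionOfSingularities.ResolutionOfSingularities.Theorems.SectionAscentFibrewiseClosedPointsCertificateRegularChart
import Summits.ResolutionOfSingularities.ResolutionOfSingularities.Theorems.FrobeniusLadderFInjectiveMacaulayficationStalkChartIso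
import Literature.AlgebraicGeometry.Resolution.AffineBlowupAlgebra
import Literature.AlgebraicGeometry.Resolution.ResolutionOfSingularities
import Mathlib.AlgebraicGeometry.AffineScheme
import Mathlib.RingTheory.FiniteType
import HarnessLib

/-!
# Cartier ascent at a certified closed point of a normal blowing up (`stub_certificateRegular`)

Crux stmt-ResolutionOfSingularities-15960 (`SectionAscent.FibrewiseClosedPoints`), line `registered`,
stub `stub_certificateRegular` — the heart of the closed-point section criterion.

`A` an integral algebra of finite type over a field `K`, `I ≠ 0`, `Bl_I(Spec A) = Proj A[It]` normal,
`y` a closed point with `dim 𝒪_y > 1` carrying a SECTION CERTIFICATE: `m ≥ 1`, `g₁, …, g_s ∈ I^m`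
with (a) all `g_j t^m ∈ 𝔭_y`, (b) every proper generization `z ⤳ y` misses some `g_j t^m`, and
(c) the blowing up along `I` of the generic member `H_g = Spec((K(t) ⊗_K A)/(Σ t_j ⊗ g_j))` is a
regular scheme. Then `𝒪_y` is regular. Assembly of the registered pieces:

* a chart `D₊(at) ∋ y` (`0 ≠ a ∈ I`; `reesT_eq_zero` of `…StalkChartIso`) and the prime `𝔮₀` of the chart ring `C₀ = (A[It])_{(at)}`
  with `𝒪_y ≅ (C₀)_{𝔮₀}` (stalks of the open immersion `Spec C₀ → Proj A[It]`); the certificate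
  read on the chart: `c_j = g_j t^m/(at)^m ∈ 𝔮₀`, missed by every prime `𝔭 ⊊ 𝔮₀`
  (Mathlib `Proj.awayι_preimage_basicOpen`);
* `…CertificateRegularBaseChange` (`B = K(t) ⊗_K A`, the injective `χ : C₀[t] → B[IB/ι(a)]` and
  generation), `…CertificateRegularStrictTransform` (the chart ring of `Bl_I(H_g)` as a quotient:
  generation and kernel of `θ₀ : C₀[t] → (B'[IB't])_{(φ(a)t)}`), whose local rings are the stalks of
  the regular scheme `Bl_I(H_g)`;
* `…CertificateRegularChart` (Nagata's `R(t)`, saturation, Cartier ascent and flat descent) with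
  `…CertificateRegularLocQuot` (local rings of a localization followed by a surjection).

References: EGA IV 0.17.1.7; Matsumura, *Commutative Ring Theory*, Thm. 23.7, Thm. 11.5;
The Stacks Project, Tag 080E, Tag 0805; Huneke–Swanson, Lemma 8.4.2.
-/

-- single-problem summit: the doubled namespace component is forced
set_option linter.dupNamespace false
-- Mathlib is built with this depth; the default (1) makes instance search on the chart rings fail
set_option maxSynthPendingDepth 3

noncomputable section

namespace Summit.ResolutionOfSingularities.ResolutionOfSingularities.Theorems.SectionAscent.CertificateRegular

open AlgebraicGeometry CategoryTheory MvPolynomial Literature.AlgebraicGeometry.Resolution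
open scoped TensorProduct BigOperators Polynomial

/-- **Stalks of `Proj` on a basic open are the local rings of the chart ring**: for a point `q` of
`Spec A_{(f)}`, the stalk of `Proj A` at its image under the open immersion `awayι` is ring-isomorphic
to `(A_{(f)})_q` (stalk maps of open immersions are isomorphisms; `Spec.stalkIso`). Recorded as:
there is a localization `R₀` of `A_{(f)}` at `q` (namely `(A_{(f)})_q`) to which normality and the
Krull dimension of the stalk transfer and whose regularity transfers back (stated generically and
with `R₀` abstract, which keeps the instance bookkeeping of the users cheap).
[cite: StacksProject, Tag 0804] -/
theorem exists_localRing_of_awayι {R A : Type} [CommRing R] [CommRing A] [Algebra R A]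
    (𝒜 : ℕ → Submodule R A) [GradedAlgebra 𝒜] {f : A} {d : ℕ} (f_deg : f ∈ 𝒜 d) (hd : 0 < d)
    (q : PrimeSpectrum (HomogeneousLocalization.Away 𝒜 f)) :
    ∃ (R₀ : Type) (_ : CommRing R₀) (_ : IsLocalRing R₀)
      (_ : Algebra (HomogeneousLocalization.Away 𝒜 f) R₀) (_ : IsLocalization.AtPrime R₀ q.asIdeal),
      (IsIntegrallyClosed ((Proj 𝒜).presheaf.stalk (Proj.awayι 𝒜 f f_deg hd q)) → IsIntegrallyClosed R₀) ∧
      ringKrullDim ((Proj 𝒜).presheaf.stalk (Proj.awayι 𝒜 f f_deg hd q)) = ringKrullDim R₀ ∧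
      (IsRegularLocalRing R₀ → IsRegularLocalRing ((Proj 𝒜).presheaf.stalk (Proj.awayι 𝒜 f f_deg hd q))) := by
  let e : (Proj 𝒜).presheaf.stalk (Proj.awayι 𝒜 f f_deg hd q) ≃+* Localization.AtPrime q.asIdeal :=
    ((asIso ((Proj.awayι 𝒜 f f_deg hd).stalkMap q)).commRingCatIsoToRingEquiv).trans
      (Spec.stalkIso (CommRingCat.of (HomogeneousLocalization.Away 𝒜 f)) q).commRingCatIsoToRingEquiv
  exact ⟨Localization.AtPrime q.asIdeal, inferInstance, inferInstance, inferInstance, inferInstance,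
    fun h => IsIntegrallyClosed.of_equiv e, ringKrullDim_eq_of_ringEquiv e,
    fun h => IsRegularLocalRing.of_ringEquiv e.symm⟩

/-- The stalk-to-chart direction: a regular stalk of `Proj A` over `D₊(f)` has regular chart local
ring `(A_{(f)})_q`. [cite: StacksProject, Tag 0804] -/
theorem isRegularLocalRing_of_stalk_awayι {R A : Type} [CommRing R] [CommRing A] [Algebra R A]
    (𝒜 : ℕ → Submodule R A) [GradedAlgebra 𝒜] {f : A} {d : ℕ} (f_deg : f ∈ 𝒜 d) (hd : 0 < d)
    (q : PrimeSpectrum (HomogeneousLocalization.Away 𝒜 f))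
    (h : IsRegularLocalRing ((Proj 𝒜).presheaf.stalk (Proj.awayι 𝒜 f f_deg hd q))) :
    IsRegularLocalRing (Localization.AtPrime q.asIdeal) :=
  IsRegularLocalRing.of_ringEquiv
    (((asIso ((Proj.awayι 𝒜 f f_deg hd).stalkMap q)).commRingCatIsoToRingEquiv).trans
      (Spec.stalkIso (CommRingCat.of (HomogeneousLocalization.Away 𝒜 f)) q).commRingCatIsoToRingEquiv)

/-- **Nagata's ring exists**: for a local ring `R₀`, some localization `T` of `R₀[t₁, …, t_n]` at the
extended maximal ideal `𝔪 R₀[t]` (namely `R₀(t) = R₀[t]_{𝔪R₀[t]}`), with its `R₀`-algebra structure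
(stated with `T` abstract, which keeps the users' instance bookkeeping cheap). [folklore] -/
theorem exists_nagataRing (R₀ : Type) [CommRing R₀] [IsLocalRing R₀] (n : ℕ) :
    haveI := isPrime_map_C (σ := Fin n) (IsLocalRing.maximalIdeal R₀)
    ∃ (T : Type) (_ : CommRing T) (_ : Algebra (MvPolynomial (Fin n) R₀) T)
      (_ : IsLocalization.AtPrime T
        (Ideal.map (MvPolynomial.C : R₀ →+* MvPolynomial (Fin n) R₀) (IsLocalRing.maximalIdeal R₀)))
      (_ : Algebra R₀ T), IsScalarTower R₀ (MvPolynomial (Fin n) R₀) T := by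
  haveI := isPrime_map_C (σ := Fin n) (IsLocalRing.maximalIdeal R₀)
  exact ⟨Localization.AtPrime (Ideal.map (MvPolynomial.C : R₀ →+* MvPolynomial (Fin n) R₀)
      (IsLocalRing.maximalIdeal R₀)),
    inferInstance, inferInstance, inferInstance, inferInstance, inferInstance⟩

/-- **Points of `Proj` over a basic open, on elements**: for `F` homogeneous of positive degree,
`F` vanishes at the image of `q ∈ Spec A_{(f)}` iff `F^{deg f}/f^{deg F} ∈ q` (Mathlib
`Proj.awayι_preimage_basicOpen`, pointwise). [folklore] -/
theorem isLocalizationElem_mem_iff {R A : Type} [CommRing R] [CommRing A] [Algebra R A]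
    (𝒜 : ℕ → Submodule R A) [GradedAlgebra 𝒜] {f : A} {d : ℕ} (f_deg : f ∈ 𝒜 d) (hd : 0 < d)
    {F : A} {e : ℕ} (F_deg : F ∈ 𝒜 e) (he : 0 < e) (q : PrimeSpectrum (HomogeneousLocalization.Away 𝒜 f)) :
    HomogeneousLocalization.Away.isLocalizationElem f_deg F_deg ∈ q.asIdeal ↔
      F ∈ (Proj.awayι 𝒜 f f_deg hd q).asHomogeneousIdeal := by
  have h := congrArg (fun U : (Spec (CommRingCat.of (HomogeneousLocalization.Away 𝒜 f))).Opens => q ∈ U)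
    (Proj.awayι_preimage_basicOpen 𝒜 f_deg hd F_deg he)
  simp only [eq_iff_iff] at h
  change (F ∉ (Proj.awayι 𝒜 f f_deg hd q).asHomogeneousIdeal ↔
    HomogeneousLocalization.Away.isLocalizationElem f_deg F_deg ∉ q.asIdeal) at h
  tauto

/-- The chart map `χ : (A[It])_{(at)}[t] → B[IB/ι(a)]` of `…CertificateRegularBaseChange` exists
(it is `eval₂` of `(A[It])_{(at)} ≅ A[I/a] → B[IB/ι(a)]` and `t_j ↦ τ(t_j)/1`; recorded generically,
where the instance bookkeeping is cheap). [folklore] -/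
theorem exists_chartPolyMap {K A : Type} [Field K] [CommRing A] (s : ℕ) {B : Type}
    [CommRing B] (ι : A →+* B) (τ : MvPolynomial (Fin s) K →+* B) {I : Ideal A} (a : A) (ha : a ∈ I) :
    ∃ χ : MvPolynomial (Fin s) (HomogeneousLocalization.Away (reesGrading I) (reesT a ha)) →+*
        blowupAlgebra (I.map ι) (ι a),
      (∀ c, χ (C c) = blowupAlgebraMap ι I (I.map ι) a le_rfl (reesChartEquiv a ha c)) ∧
      (∀ j, χ (X j) = algebraMap B (blowupAlgebra (I.map ι) (ι a)) (τ (X j))) :=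
  ⟨MvPolynomial.eval₂Hom ((blowupAlgebraMap ι I (I.map ι) a le_rfl).comp (reesChartEquiv a ha).toRingHom)
      (fun j => algebraMap B (blowupAlgebra (I.map ι) (ι a)) (τ (X j))),
    fun c => eval₂Hom_C _ _ c, fun j => eval₂Hom_X' _ _ j⟩

/-- The strict-transform chart map `θ₀ : (A[It])_{(at)}[t] → (B'[IB't])_{(φ(a)t)}` of
`…CertificateRegularStrictTransform` exists (recorded generically). [folklore] -/
theorem exists_sectionChartMap₀ {A : Type} [CommRing A] (s : ℕ) {B B' : Type} [CommRing B]
    [CommRing B'] (ι : A →+* B) (q : B →+* B') {I : Ideal A} (a : A) (ha : a ∈ I)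
    (χ : MvPolynomial (Fin s) (HomogeneousLocalization.Away (reesGrading I) (reesT a ha)) →+*
      blowupAlgebra (I.map ι) (ι a)) (hmem : q (ι a) ∈ I.map (q.comp ι)) :
    ∃ θ₀ : MvPolynomial (Fin s) (HomogeneousLocalization.Away (reesGrading I) (reesT a ha)) →+*
        HomogeneousLocalization.Away (reesGrading (I.map (q.comp ι))) (reesT (q (ι a)) hmem),
      ∀ d, θ₀ d = (reesChartEquiv (q (ι a)) hmem).symm
        (blowupAlgebraMap q (I.map ι) (I.map (q.comp ι)) (ι a) (Ideal.map_map ι q).le (χ d)) :=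
  ⟨(reesChartEquiv (q (ι a)) hmem).symm.toRingHom.comp
      ((blowupAlgebraMap q (I.map ι) (I.map (q.comp ι)) (ι a) (Ideal.map_map ι q).le).comp χ),
    fun _ => rfl⟩

set_option maxHeartbeats 400000 in
/-- STUB `stub_certificateRegular` of line `registered` (crux `SectionAscent.FibrewiseClosedPoints`):
**Cartier ascent at a certified closed point.** See the module docstring.
[cite: EGAIV4, 0.17.1.7; Matsumura1987, Thm. 23.7; StacksProject, Tag 080E; HunekeSwanson2006, Lemma 8.4.2] -/
theorem stub_certificateRegular (K : Type) [Field K] (A : Type) [CommRing A] [IsDomain A]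
    [Algebra K A] [Algebra.FiniteType K A] (I : Ideal A) (hI : I ≠ ⊥)
    (hnorm : ∀ y : Literature.AlgebraicGeometry.Resolution.affineBlowup I,
      IsIntegrallyClosed ((Literature.AlgebraicGeometry.Resolution.affineBlowup I).presheaf.stalk y))
    (y : Literature.AlgebraicGeometry.Resolution.affineBlowup I)
    (hy : IsClosed ({y} : Set (Literature.AlgebraicGeometry.Resolution.affineBlowup I)))
    (hdim : 1 < ringKrullDim ((Literature.AlgebraicGeometry.Resolution.affineBlowup I).presheaf.stalk y))
    (m s : ℕ) (g : Fin s → A) (hg : ∀ j, g j ∈ I ^ m) (hm : 0 < m)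
    (ha : ∀ j, (⟨Polynomial.monomial m (g j), reesAlgebra.monomial_mem.mpr (hg j)⟩ : reesAlgebra I) ∈
      y.asHomogeneousIdeal)
    (hb : ∀ z : Literature.AlgebraicGeometry.Resolution.affineBlowup I, z ⤳ y → z ≠ y →
      ∃ j, (⟨Polynomial.monomial m (g j), reesAlgebra.monomial_mem.mpr (hg j)⟩ : reesAlgebra I) ∉
        z.asHomogeneousIdeal)
    (hc : let Ks := FractionRing (MvPolynomial (Fin s) K)
      let ℓ : TensorProduct K Ks A :=
        ∑ j : Fin s, (algebraMap (MvPolynomial (Fin s) K) Ks (MvPolynomial.X j)) ⊗ₜ[K] g j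
      let φ : A →+* (TensorProduct K Ks A ⧸ Ideal.span {ℓ}) :=
        (Ideal.Quotient.mk (Ideal.span {ℓ})).comp
          (Algebra.TensorProduct.includeRight (R := K) (A := Ks) (B := A)).toRingHom
      Literature.AlgebraicGeometry.Resolution.Scheme.IsRegular
        (Literature.AlgebraicGeometry.Resolution.affineBlowup (I.map φ))) :
    IsRegularLocalRing ((Literature.AlgebraicGeometry.Resolution.affineBlowup I).presheaf.stalk y) := by
  have _hI : I ≠ ⊥ := hI
  haveI : IsNoetherianRing A := Algebra.FiniteType.isNoetherianRing K A
  -- the sections `g_j t^m` are homogeneous of degree `m`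
  have Fdeg : ∀ j, (⟨Polynomial.monomial m (g j), reesAlgebra.monomial_mem.mpr (hg j)⟩ : reesAlgebra I) ∈
      reesGrading I m := fun j => ⟨g j, rfl⟩
  -- a chart `D₊(at) ∋ y` with `a ≠ 0`
  obtain ⟨b, hyb⟩ : ∃ b : I, y ∈ Proj.basicOpen (reesGrading I) (reesT b.1 b.2) := by
    have : y ∈ (⨆ b : I, Proj.basicOpen (reesGrading I) (reesT (I := I) b.1 b.2)) := by
      rw [affineBlowup.iSup_basicOpen_reesT_eq_top I]; trivial
    exact TopologicalSpace.Opens.mem_iSup.mp this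
  obtain ⟨a, haI⟩ := b
  have ha0 : a ≠ 0 := by
    intro h0
    rw [Summit.ResolutionOfSingularities.ResolutionOfSingularities.Theorems.FInjectiveMacaulayfication.StalkChartIso.reesT_eq_zero
      a haI h0, Proj.basicOpen_zero] at hyb
    exact hyb
  -- the prime `𝔮₀` of the chart ring with `y = awayι 𝔮₀`
  rw [← Proj.opensRange_awayι (reesGrading I) (reesT a haI) (reesT_mem a haI) one_pos] at hyb
  obtain ⟨𝔮₀, rfl⟩ := Scheme.Hom.mem_opensRange.mp hyb
  -- the stalk `R = 𝒪_y ≅ R₀ = (C₀)_{𝔮₀}` (kept abstract) and Nagata's ring `T = R₀(t)`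
  obtain ⟨R₀, _, _, _, _, hIC, hdimEq, hregOf⟩ :=
    exists_localRing_of_awayι (reesGrading I) (reesT_mem a haI) one_pos 𝔮₀
  have hnorm' := hIC (hnorm _)
  have hdim' := lt_of_lt_of_eq hdim hdimEq
  obtain ⟨T, _, _, _, _, _⟩ := exists_nagataRing R₀ s
  -- the certificate on the chart: `c_j = g_j t^m / (at)^m`
  obtain ⟨c, hcdef⟩ : ∃ c : Fin s → HomogeneousLocalization.Away (reesGrading I) (reesT a haI),
      ∀ j, c j = HomogeneousLocalization.Away.isLocalizationElem (reesT_mem a haI) (Fdeg j) :=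
    ⟨_, fun j => rfl⟩
  have hcF : ∀ (q : PrimeSpectrum (HomogeneousLocalization.Away (reesGrading I) (reesT a haI))) j,
      c j ∈ q.asIdeal ↔
        (⟨Polynomial.monomial m (g j), reesAlgebra.monomial_mem.mpr (hg j)⟩ : reesAlgebra I) ∈
          (Proj.awayι (reesGrading I) (reesT a haI) (reesT_mem a haI) one_pos q).asHomogeneousIdeal := by
    intro q j
    rw [hcdef]
    exact isLocalizationElem_mem_iff (reesGrading I) (reesT_mem a haI) one_pos (Fdeg j) hm q
  have hca : ∀ j, c j ∈ 𝔮₀.asIdeal := fun j => (hcF 𝔮₀ j).mpr (ha j)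
  have hcb : ∀ 𝔭 : PrimeSpectrum (HomogeneousLocalization.Away (reesGrading I) (reesT a haI)),
      𝔭 ≤ 𝔮₀ → 𝔭 ≠ 𝔮₀ → ∃ j, c j ∉ 𝔭.asIdeal := by
    intro 𝔭 hle hne
    have hz : Proj.awayι (reesGrading I) (reesT a haI) (reesT_mem a haI) one_pos 𝔭 ⤳
        Proj.awayι (reesGrading I) (reesT a haI) (reesT_mem a haI) one_pos 𝔮₀ :=
      ((PrimeSpectrum.le_iff_specializes 𝔭 𝔮₀).mp hle).map
        (Proj.awayι (reesGrading I) (reesT a haI) (reesT_mem a haI) one_pos).base.hom.continuous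
    have hne' : Proj.awayι (reesGrading I) (reesT a haI) (reesT_mem a haI) one_pos 𝔭 ≠
        Proj.awayι (reesGrading I) (reesT a haI) (reesT_mem a haI) one_pos 𝔮₀ := fun h =>
      hne ((Proj.awayι (reesGrading I) (reesT a haI) (reesT_mem a haI) one_pos).isOpenEmbedding.injective h)
    obtain ⟨j, hj⟩ := hb _ hz hne'
    exact ⟨j, fun h => hj ((hcF 𝔭 j).mp h)⟩
  have hcrel : ∀ j, reesChartBase a haI (a ^ m) * c j = reesChartBase a haI (g j) := by
    intro j
    apply reesChart_injective a haI
    have hF1 : (((⟨Polynomial.monomial m (g j), reesAlgebra.monomial_mem.mpr (hg j)⟩ : reesAlgebra I) ^ 1 :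
        reesAlgebra I) : Polynomial A) = Polynomial.monomial m (g j) := by
      rw [pow_one]
    rw [map_mul, reesChart_reesChartBase, reesChart_reesChartBase, hcdef]
    change algebraMap A (Localization.Away a) (a ^ m) *
      reesChart a haI (HomogeneousLocalization.Away.mk (reesGrading I) (reesT_mem a haI) m _ _) = _
    rw [reesChart_mk a haI _ hF1, map_pow, mul_left_comm, ← mul_pow, IsLocalization.Away.mul_invSelf,
      one_pow, mul_one]
  -- the base change `B = K(t) ⊗_K A` and the generic member `ℓ`
  let ι : A →+* TensorProduct K (FractionRing (MvPolynomial (Fin s) K)) A :=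
    (Algebra.TensorProduct.includeRight (R := K) (A := FractionRing (MvPolynomial (Fin s) K)) (B := A)).toRingHom
  let τ : MvPolynomial (Fin s) K →+* TensorProduct K (FractionRing (MvPolynomial (Fin s) K)) A :=
    (Algebra.TensorProduct.includeLeftRingHom (R := K) (A := FractionRing (MvPolynomial (Fin s) K)) (B := A)).comp
      (algebraMap (MvPolynomial (Fin s) K) (FractionRing (MvPolynomial (Fin s) K)))
  obtain ⟨hιτ, -, hΦ, hgenB⟩ := tensor_baseChange_hypotheses K A s ι τ (fun r => rfl) (fun p => rfl)
  -- the chart map `χ : C₀[t] → B[IB/ι(a)]` and the strict-transform chart map `θ₀`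
  obtain ⟨χ, hχC, hχX⟩ := exists_chartPolyMap s ι τ a haI
  obtain ⟨hχinj, hχgen⟩ := stub_certificateRegularBaseChange K A s _ ι τ hιτ hΦ hgenB I a haI χ hχC hχX
  let ℓ : TensorProduct K (FractionRing (MvPolynomial (Fin s) K)) A :=
    ∑ j : Fin s, (algebraMap (MvPolynomial (Fin s) K) (FractionRing (MvPolynomial (Fin s) K))
      (MvPolynomial.X j)) ⊗ₜ[K] g j
  have hℓ : ℓ = ∑ j : Fin s, τ (X j) * ι (g j) := by
    refine Finset.sum_congr rfl fun j _ => ?_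
    change _ = (_ ⊗ₜ[K] (1 : A)) * ((1 : FractionRing (MvPolynomial (Fin s) K)) ⊗ₜ[K] g j)
    rw [Algebra.TensorProduct.tmul_mul_tmul, mul_one, one_mul]
  -- the generic hypersurface section `B' = B/(ℓ)` (kept abstract from here on) and hypothesis (c)
  have hc' : Scheme.IsRegular (affineBlowup (I.map ((Ideal.Quotient.mk (Ideal.span {ℓ})).comp ι))) := hc
  obtain ⟨B', _instB', q, hq, hkq, hcq⟩ : ∃ (B' : Type) (_ : CommRing B')
      (q : TensorProduct K (FractionRing (MvPolynomial (Fin s) K)) A →+* B'),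
      Function.Surjective q ∧ RingHom.ker q = Ideal.span {∑ j : Fin s, τ (X j) * ι (g j)} ∧
        Scheme.IsRegular (affineBlowup (I.map (q.comp ι))) :=
    ⟨_, inferInstance, Ideal.Quotient.mk (Ideal.span {ℓ}), Ideal.Quotient.mk_surjective,
      by rw [← hℓ]; exact Ideal.mk_ker, hc'⟩
  have hmem : q (ι a) ∈ I.map (q.comp ι) := Ideal.mem_map_of_mem (q.comp ι) haI
  obtain ⟨θ₀, hθ₀⟩ := exists_sectionChartMap₀ s ι q a haI χ hmem
  obtain ⟨hgenE, hkerE, hθℓ, hθa⟩ := stub_certificateRegularStrictTransform K A s _ ι τ g _ q hq hkq I a haI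
    χ hχC hχX hχinj hχgen hmem θ₀ hθ₀
  -- the local rings of the chart of `Bl_I(H_g)` are regular
  have hreg : ∀ 𝔮 : PrimeSpectrum (HomogeneousLocalization.Away (reesGrading (I.map (q.comp ι)))
      (reesT (q (ι a)) hmem)), IsRegularLocalRing (Localization.AtPrime 𝔮.asIdeal) := by
    intro 𝔮
    exact isRegularLocalRing_of_stalk_awayι (reesGrading (I.map (q.comp ι))) (reesT_mem (q (ι a)) hmem)
      one_pos 𝔮 (hcq _)
  -- Cartier ascent on Nagata's ring and flat descent (the chart theorem)
  refine hregOf <|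
    stub_certificateRegularChart K A I a haI ha0 s m g 𝔮₀ R₀ hnorm' hdim' T c hcrel hca hcb _ θ₀ hgenE
      hkerE hθℓ hθa hreg
      (fun S 𝔔 _ h1 h2 h3 T' _ _ _ => exists_primeSpectrum_ringEquiv_quotient θ₀ S 𝔔 h1 h2 h3 T')

end Summit.ResolutionOfSingularities.ResolutionOfSingularities.Theorems.SectionAscent.CertificateRegular

end
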